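import Summits.QuantumAdvantage.QuantumAdvantage.Theorems.CubicForrelationNearExactIsExactTwelveOddWeightR4Rank
import Summits.QuantumAdvantage.QuantumAdvantage.Theorems.CubicForrelationExactPairsMaioranaMcFarlandDefectVanishing

/-!
# Crux `CubicForrelation.NearExactIsExact` (stmt-QuantumAdvantage-14043) — n = 12, WEIGHT OF A TYPE-O CUBIC, III: case R2 — a derivative with
  exactly `1024` ones forces weight `≥ 1304`

Certificate seat `b2b-cforr-cert` (gen 32).  HONEST FRAMING: a kernel-checked finite-slice theorem (standard axioms) — one of the two cases of "a cubic
Boolean function on 12 bits with weight `≡ 8 (mod 16)` has weight `≥ 1280`" (…TwelveOddWeight*, killing the "`κ₁` type O" branch of the wild (O,O)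
analysis of the open window `(57/64, 29/32)`).  NOT summit progress; no value of `θ₁₂`.

`tow_weight_R2`: `κ` cubic on 12 bits, `wt κ ≡ 8 (mod 16)`, and some `a ≠ 0` with `#{x : κ x ≠ κ(x⊕a)} = 1024`.  Then `wt κ ≥ 1304`.
Proof.  `D_aκ` is a minimum-weight quadratic, so its support is a 10-flat `U = {⟨x,z₁⟩ = b₁, ⟨x,z₂⟩ = b₂}` (`kt3_minweight_quadratic_cells`), invariant
under `a` (`⟨a,zᵢ⟩` even); pick `z₃` with `⟨a,z₃⟩` odd.  The eight parity cells of `(z₁,z₂,z₃)` are 9-flats (cosets of one annihilator with `512`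
points); `x ↦ x ⊕ a` maps the cell `c` onto the cell with the third parity flipped and `κ(x⊕a) = κ(x) ⊕ [x ∈ U]`, so paired cells OFF `U` carry
equally many ones and the two cells ON `U` carry `512` together.  By the TYPE PRINCIPLE (`tow_flat_type`) all eight cells have the same residue
`4N (mod 8)`; `wt ≡ 8 (mod 16)` forces `N` odd; so each of the six cells off `U` has `≥ 132` ones (`tow_flat9_kt`) and `wt ≥ 512 + 6·132 = 1304`.

References: T. Kasami, N. Tokura (1970) Thm 1; F. J. MacWilliams, N. J. A. Sloane (1977) Ch. 13 §4, Ch. 15 §2.  Axioms: the standard three.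
-/

set_option linter.dupNamespace false -- D-0017: single-problem summit ⇒ `QuantumAdvantage.QuantumAdvantage` by design

noncomputable section

namespace Summit.QuantumAdvantage.QuantumAdvantage.Theorems.CubicForrelation.NearExactIsExact

open Finset
open Literature.Computability.QuantumComplexity
open Literature.Computability.QuantumComplexity.BuzetChailloux (bxor zeroVec bxor_bxor_cancel_left bxor_zeroVec zeroVec_bxor bxor_comm
  bxor_self twist_bxor_right twist_zeroVec_right sum_twist_left bxor_eq_zeroVec_iff)
open Literature.Computability.QuantumComplexity.DerivativeWalsh (W twist_bxor_left)
open Summit.QuantumAdvantage.QuantumAdvantage.Theorems.CubicForrelation.ExactPairsMaioranaMcFarland (dv_bxor_cancel_right)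

/-! ### Small tools -/

/-- **Counting through a translation.**  If `x ↦ x ⊕ a` maps `C` onto `C'` then `#{x ∈ C' : κ x} = #{x ∈ C : κ(x ⊕ a)}`. [folklore] -/
theorem tow_card_filter_translate {m : ℕ} (C C' : Finset (Fin m → Bool)) (a : Fin m → Bool) (κ : (Fin m → Bool) → Bool)
    (hCC' : ∀ x, x ∈ C ↔ bxor x a ∈ C') :
    #(C'.filter fun x => κ x = true) = #(C.filter fun x => κ (bxor x a) = true) := by
  classical
  symm
  refine card_nbij' (fun x => bxor x a) (fun x => bxor x a) (fun x hx => ?_) (fun x hx => ?_)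
    (fun x _ => dv_bxor_cancel_right x a) (fun x _ => dv_bxor_cancel_right x a)
  · obtain ⟨hx, hκ⟩ := mem_filter.1 hx
    exact mem_filter.2 ⟨(hCC' x).1 hx, hκ⟩
  · obtain ⟨hx, hκ⟩ := mem_filter.1 hx
    refine mem_filter.2 ⟨?_, by rw [dv_bxor_cancel_right]; exact hκ⟩
    rw [hCC', dv_bxor_cancel_right]; exact hx

/-- The three forms `![z₁, z₂, z₃]`: `∀ i` versus the conjunction. [folklore] -/
theorem tow_forall_fin3 {α : Type*} (P : α → Prop) (z₁ z₂ z₃ : α) :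
    (∀ i : Fin 3, P (![z₁, z₂, z₃] i)) ↔ P z₁ ∧ P z₂ ∧ P z₃ := by
  constructor
  · intro h; exact ⟨h 0, h 1, h 2⟩
  · rintro ⟨h1, h2, h3⟩ i
    fin_cases i
    · exact h1
    · exact h2
    · exact h3

/-- Summing a function on `𝔽₂³` over its eight points. [folklore] -/
theorem tow_sum_fin3 (F : (Fin 3 → Bool) → ℕ) :
    ∑ c : Fin 3 → Bool, F c =
      F ![true, true, true] + F ![true, true, false] + F ![true, false, true] + F ![true, false, false] +
        F ![false, true, true] + F ![false, true, false] + F ![false, false, true] + F ![false, false, false] := by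
  let e : (Fin 3 → Bool) ≃ Bool × Bool × Bool :=
    ⟨fun c => (c 0, c 1, c 2), fun t => ![t.1, t.2.1, t.2.2], fun c => by funext i; fin_cases i <;> rfl, fun t => rfl⟩
  rw [Fintype.sum_equiv e F (fun t => F ![t.1, t.2.1, t.2.2]) (fun c => by
    show F c = F ![c 0, c 1, c 2]; congr 1; funext i; fin_cases i <;> rfl)]
  rw [Fintype.sum_prod_type, Fintype.sum_bool, Fintype.sum_prod_type, Fintype.sum_prod_type, Fintype.sum_bool, Fintype.sum_bool,
    Fintype.sum_bool, Fintype.sum_bool, Fintype.sum_bool, Fintype.sum_bool]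
  ring

/-! ### Case R2 -/

/-- **Arithmetic of case R2.**  Eight cell counts in four pairs `(s₁,t₁),…,(s₄,t₄)`: the first pair sums to `512`, the other pairs are
equal, all eight counts have the same residue `mod 8`, a count `≡ 4 (mod 8)` is `≥ 132`, and the total is `≡ 8 (mod 16)`; then the total is
`≥ 1304`. [this work] -/
theorem tow_R2_arith (R : ℤ) (s₁ t₁ s₂ t₂ s₃ t₃ s₄ t₄ : ℕ) (hon : s₁ + t₁ = 512) (h2 : t₂ = s₂) (h3 : t₃ = s₃) (h4 : t₄ = s₄)
    (r₁ : (s₁ : ℤ) % 8 = R % 8) (q₁ : (t₁ : ℤ) % 8 = R % 8) (r₂ : (s₂ : ℤ) % 8 = R % 8) (r₃ : (s₃ : ℤ) % 8 = R % 8)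
    (r₄ : (s₄ : ℤ) % 8 = R % 8)
    (k₂ : s₂ % 8 = 4 → 132 ≤ s₂) (k₃ : s₃ % 8 = 4 → 132 ≤ s₃) (k₄ : s₄ % 8 = 4 → 132 ≤ s₄)
    (htot : (s₁ + t₁ + s₂ + t₂ + s₃ + t₃ + s₄ + t₄) % 16 = 8) :
    1304 ≤ s₁ + t₁ + s₂ + t₂ + s₃ + t₃ + s₄ + t₄ := by
  have hR : R % 8 = 4 := by omega
  have e₂ : s₂ % 8 = 4 := by omega
  have e₃ : s₃ % 8 = 4 := by omega
  have e₄ : s₄ % 8 = 4 := by omega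
  have := k₂ e₂; have := k₃ e₃; have := k₄ e₄
  omega

/-- **The frame of case R2.**  For a cubic `κ` on 12 bits and `a ≠ 0` with `#{x : κ x ≠ κ(x⊕a)} = 1024`: three forms `z₀, z₁, z₂` no non-empty
xor of which vanishes, with `{x : κ x ≠ κ(x⊕a)} = {⟨x,z₀⟩ = b₁, ⟨x,z₁⟩ = b₂}`, `⟨a,z₀⟩, ⟨a,z₁⟩` even and `⟨a,z₂⟩` odd.
[cite: MacWilliamsSloane1977, Ch. 13 §4] -/
theorem tow_R2_frame (κ : (Fin (6 + 6) → Bool) → Bool) (hκ : IsDegLeFun 3 κ)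
    (a : Fin (6 + 6) → Bool) (ha : a ≠ zeroVec) (hDa : #(univ.filter fun x => (κ x ^^ κ (bxor x a)) = true) = 1024) :
    ∃ (zz : Fin 3 → Fin (6 + 6) → Bool) (b₁ b₂ : Bool),
      (∀ x, (κ x ^^ κ (bxor x a)) = true ↔ (decide (Odd #(univ.filter fun j => x j && zz 0 j)) = b₁ ∧
        decide (Odd #(univ.filter fun j => x j && zz 1 j)) = b₂)) ∧
      decide (Odd #(univ.filter fun j => a j && zz 0 j)) = false ∧ decide (Odd #(univ.filter fun j => a j && zz 1 j)) = false ∧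
      decide (Odd #(univ.filter fun j => a j && zz 2 j)) = true ∧
      ∀ ε : Fin 3 → Bool, ε ≠ (fun _ => false) →
        (fun j => (zeroVec : Fin (6 + 6) → Bool) j ^^ decide (Odd #(univ.filter fun i => ε i && zz i j))) ≠ zeroVec := by
  classical
  have hq : IsDegLeFun 2 (fun x => κ x ^^ κ (bxor x a)) := stub_derivDegree (6 + 6) 2 κ a hκ
  obtain ⟨z₁, z₂, b₁, b₂, hz₁, hz₂, h12, hU⟩ :=
    kt3_minweight_quadratic_cells (fun x => κ x ^^ κ (bxor x a)) hq (by rw [hDa]; norm_num)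
  -- `⟨a, z₁⟩`, `⟨a, z₂⟩` are even
  have hqa : ∀ x, (κ (bxor x a) ^^ κ (bxor (bxor x a) a)) = (κ x ^^ κ (bxor x a)) := fun x => by
    rw [dv_bxor_cancel_right, Bool.xor_comm]
  obtain ⟨x₀, hx₀⟩ : ∃ x₀, (κ x₀ ^^ κ (bxor x₀ a)) = true := by
    by_contra hno
    push Not at hno
    have : #(univ.filter fun x => (κ x ^^ κ (bxor x a)) = true) = 0 := by
      rw [card_eq_zero, filter_eq_empty_iff]; intro x _; exact hno x
    omega
  have hpa : ∀ (z : Fin (6 + 6) → Bool) (b : Bool),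
      (∀ x, (κ x ^^ κ (bxor x a)) = true → decide (Odd #(univ.filter fun j => x j && z j)) = b) →
      decide (Odd #(univ.filter fun j => a j && z j)) = false := by
    intro z b hz
    have h1 := hz x₀ hx₀
    have h2 := hz (bxor x₀ a) (by rw [hqa]; exact hx₀)
    rw [tow_parity_bxor, h1] at h2
    revert h2; cases b <;> cases decide (Odd #(univ.filter fun j => a j && z j)) <;> simp
  have ha₁ : decide (Odd #(univ.filter fun j => a j && z₁ j)) = false := hpa z₁ b₁ fun x hx => ((hU x).1 hx).1
  have ha₂ : decide (Odd #(univ.filter fun j => a j && z₂ j)) = false := hpa z₂ b₂ fun x hx => ((hU x).1 hx).2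
  -- a third form with `⟨a, z₃⟩` odd
  obtain ⟨z₃, hz₃⟩ := es_exists_twist_neg ha
  have ha₃ : decide (Odd #(univ.filter fun j => a j && z₃ j)) = true := by
    rw [vg_twist_eq_signOf] at hz₃
    revert hz₃; cases decide (Odd #(univ.filter fun j => a j && z₃ j)) <;> norm_num [signOf]
  refine ⟨![z₁, z₂, z₃], b₁, b₂, hU, ha₁, ha₂, ha₃, ?_⟩
  -- independence
  intro ε hε
  rw [tow_flatPt_three]
  have e3 : ε = ![ε 0, ε 1, ε 2] := by funext i; fin_cases i <;> rfl
  have hza : ∀ v : Fin (6 + 6) → Bool, decide (Odd #(univ.filter fun j => a j && v j)) = true → v ≠ zeroVec := by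
    intro v hv h0; rw [h0] at hv; simp [zeroVec] at hv
  have hcomb : ∀ v : Fin (6 + 6) → Bool, decide (Odd #(univ.filter fun j => a j && v j)) = false →
      (fun j => v j ^^ z₃ j) ≠ zeroVec := by
    intro v hv
    apply hza
    have := tow_parity_bxor v z₃ a
    rw [tow_parity_comm (bxor v z₃) a, tow_parity_comm v a, tow_parity_comm z₃ a, hv, ha₃] at this
    simpa [bxor] using this
  have h12' : (fun j => z₁ j ^^ z₂ j) ≠ zeroVec := fun h => h12 (by
    funext j; have := congrFun h j; simp only [zeroVec] at this
    revert this; cases z₁ j <;> cases z₂ j <;> simp)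
  have ha12 : decide (Odd #(univ.filter fun j => a j && (fun j => z₁ j ^^ z₂ j) j)) = false := by
    have := tow_parity_bxor z₁ z₂ a
    rw [tow_parity_comm (bxor z₁ z₂) a, tow_parity_comm z₁ a, tow_parity_comm z₂ a, ha₁, ha₂] at this
    simpa [bxor] using this
  simp only [Matrix.cons_val_zero, Matrix.cons_val_one, Matrix.head_cons, Matrix.cons_val_two, Matrix.tail_cons]
  rcases Bool.eq_false_or_eq_true (ε 0) with h0 | h0 <;> rcases Bool.eq_false_or_eq_true (ε 1) with h1 | h1 <;>
    rcases Bool.eq_false_or_eq_true (ε 2) with h2 | h2 <;>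
    simp only [h0, h1, h2, Bool.true_and, Bool.false_and, Bool.false_xor, Bool.xor_false, zeroVec]
  · exact hcomb _ ha12
  · exact h12'
  · exact hcomb _ ha₁
  · exact fun h => hz₁ (by simpa [zeroVec] using h)
  · exact hcomb _ ha₂
  · exact fun h => hz₂ (by simpa [zeroVec] using h)
  · exact hza z₃ ha₃
  · exact absurd (by rw [e3, h0, h1, h2]; funext i; fin_cases i <;> rfl) hε

set_option maxHeartbeats 800000 in
/-- **Case R2.**  A cubic `κ` on 12 bits with `wt κ ≡ 8 (mod 16)` and a direction `a ≠ 0` along which exactly `1024` points change value has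
`wt κ ≥ 1304`.  Finite-slice statement, NOT summit progress. [this work] -/
theorem tow_weight_R2 (κ : (Fin (6 + 6) → Bool) → Bool) (hκ : IsDegLeFun 3 κ)
    (hw : #(univ.filter fun x : Fin (6 + 6) → Bool => κ x = true) % 16 = 8)
    (a : Fin (6 + 6) → Bool) (ha : a ≠ zeroVec) (hDa : #(univ.filter fun x => (κ x ^^ κ (bxor x a)) = true) = 1024) :
    1304 ≤ #(univ.filter fun x : Fin (6 + 6) → Bool => κ x = true) := by
  classical
  obtain ⟨u, hu, hodd⟩ := tow_typeO_of_weight κ hκ hw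
  obtain ⟨zz, b₁, b₂, hU, ha₁, ha₂, ha₃, hind⟩ := tow_R2_frame κ hκ a ha hDa
  -- the annihilator and the cells
  set T := univ.filter (fun x : Fin (6 + 6) → Bool => ∀ i, twist (zz i) x = 1) with hTdef
  have hTeq : T = univ.filter fun x : Fin (6 + 6) → Bool => ∀ i, decide (Odd #(univ.filter fun j => x j && zz i j)) = false :=
    filter_congr fun x _ => forall_congr' fun i => by
      rw [Literature.Computability.QuantumComplexity.twist_comm, tow_twist_eq_one_iff_parity]
  have hpow3 : (2 : ℕ) ^ 3 = 8 := by norm_num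
  have hpow12 : (2 : ℕ) ^ (6 + 6) = 4096 := by norm_num
  have hT : #T = 512 := by
    have h := tow_card_paritySet zz (fun _ => false) hind
    rw [← hTeq, hpow3, hpow12] at h
    omega
  set cell : (Fin 3 → Bool) → Finset (Fin (6 + 6) → Bool) :=
    fun c => univ.filter fun x : Fin (6 + 6) → Bool => ∀ i, decide (Odd #(univ.filter fun j => x j && zz i j)) = c i with hcelldef
  have hcell_card : ∀ c, #(cell c) = 512 := fun c => by
    have h := tow_card_paritySet zz c hind
    rw [hpow3, hpow12] at h
    show #(univ.filter fun x : Fin (6 + 6) → Bool => ∀ i, decide (Odd #(univ.filter fun j => x j && zz i j)) = c i) = 512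
    omega
  have hrep : ∀ c, ∃ p, p ∈ cell c := fun c => by
    have h : 0 < #(cell c) := by rw [hcell_card]; norm_num
    obtain ⟨p, hp⟩ := card_pos.1 h
    exact ⟨p, hp⟩
  have hcell_img : ∀ c p, p ∈ cell c → cell c = T.image (bxor p) := fun c p hp =>
    tow_paritySet_eq_image zz c p (mem_filter.1 hp).2
  set s : (Fin 3 → Bool) → ℕ := fun c => #((cell c).filter fun x => κ x = true) with hsdef
  -- TYPE PRINCIPLE and Kasami–Tokura on every cell
  set N : ℕ := #(univ.filter fun ε : Fin 3 → Bool =>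
    decide (Odd (u (fun j => zeroVec j ^^ decide (Odd #(univ.filter fun i => ε i && zz i j))) / 2 / 2)) = true) with hNdef
  have hres : ∀ c, ((s c : ℕ) : ℤ) % 8 = (4 * (N : ℤ)) % 8 := fun c => by
    obtain ⟨p, hp⟩ := hrep c
    have h := tow_flat_type κ hκ u hu hodd zz hT p
    rw [← hcell_img c p hp] at h
    exact h
  have hkt : ∀ c, s c % 8 = 4 → 132 ≤ s c := fun c h4 => by
    obtain ⟨p, hp⟩ := hrep c
    have h := tow_flat9_kt κ hκ zz hT p
    rw [← hcell_img c p hp] at h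
    exact h h4
  -- pairing by `x ↦ x ⊕ a`
  set δ : Fin 3 → Bool := ![false, false, true] with hδdef
  have hδ : ∀ i, decide (Odd #(univ.filter fun j => a j && zz i j)) = δ i := by
    intro i; fin_cases i
    · exact ha₁
    · exact ha₂
    · exact ha₃
  have hmove : ∀ c x, x ∈ cell c ↔ bxor x a ∈ cell (fun i => c i ^^ δ i) := by
    intro c x
    simp only [hcelldef, mem_filter, mem_univ, true_and]
    refine forall_congr' fun i => ?_
    rw [tow_parity_bxor, hδ i]
    cases decide (Odd #(univ.filter fun j => x j && zz i j)) <;> cases c i <;> cases δ i <;> simp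
  have hκa : ∀ x, κ (bxor x a) = (κ x ^^ (κ x ^^ κ (bxor x a))) := fun x => by cases κ x <;> cases κ (bxor x a) <;> rfl
  have honq : ∀ c x, x ∈ cell c → ((κ x ^^ κ (bxor x a)) = true ↔ (c 0 = b₁ ∧ c 1 = b₂)) := by
    intro c x hx
    have hx' := (mem_filter.1 hx).2
    rw [hU x, ← hx' 0, ← hx' 1]
  have hpair_off : ∀ c, ¬ (c 0 = b₁ ∧ c 1 = b₂) → s (fun i => c i ^^ δ i) = s c := by
    intro c hoff
    show #((cell (fun i => c i ^^ δ i)).filter fun x => κ x = true) = #((cell c).filter fun x => κ x = true)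
    rw [tow_card_filter_translate (cell c) (cell fun i => c i ^^ δ i) a κ (hmove c)]
    refine congrArg card (filter_congr fun x hx => ?_)
    rw [hκa x]
    have hq0 : (κ x ^^ κ (bxor x a)) = false := by
      have := honq c x hx; revert this; cases (κ x ^^ κ (bxor x a)) <;> simp [hoff]
    rw [hq0, Bool.xor_false]
  have hpair_on : ∀ c, (c 0 = b₁ ∧ c 1 = b₂) → s (fun i => c i ^^ δ i) + s c = 512 := by
    intro c hon
    have hc := card_filter_add_card_filter_not (s := cell c) (fun x => κ x = true)
    rw [hcell_card] at hc
    have e : ((cell c).filter fun x => κ (bxor x a) = true) = (cell c).filter fun x => ¬ (κ x = true) := by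
      refine filter_congr fun x hx => ?_
      rw [hκa x, (honq c x hx).2 hon]
      cases κ x <;> simp
    show #((cell (fun i => c i ^^ δ i)).filter fun x => κ x = true) + #((cell c).filter fun x => κ x = true) = 512
    rw [tow_card_filter_translate (cell c) (cell fun i => c i ^^ δ i) a κ (hmove c), e]
    omega
  -- the weight is the sum over the eight cells
  have hwt : #(univ.filter fun x : Fin (6 + 6) → Bool => κ x = true) = ∑ c : Fin 3 → Bool, s c := by
    rw [card_eq_sum_card_fiberwise (f := fun x : Fin (6 + 6) → Bool => fun i : Fin 3 =>
      decide (Odd #(univ.filter fun j => x j && zz i j))) (t := univ) (fun _ _ => mem_univ _)]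
    refine sum_congr rfl fun c _ => ?_
    show #((univ.filter fun x : Fin (6 + 6) → Bool => κ x = true).filter fun x =>
        (fun i : Fin 3 => decide (Odd #(univ.filter fun j => x j && zz i j))) = c) =
      #((univ.filter fun x : Fin (6 + 6) → Bool => ∀ i, decide (Odd #(univ.filter fun j => x j && zz i j)) = c i).filter
        fun x => κ x = true)
    rw [filter_filter, filter_filter]
    exact congrArg card (filter_congr fun x _ => by simp only [funext_iff]; exact and_comm)
  rw [hwt, tow_sum_fin3]
  rw [hwt, tow_sum_fin3] at hw
  -- arithmetic
  have eδ : ∀ x y : Bool, (fun i => (![x, y, false] : Fin 3 → Bool) i ^^ δ i) = ![x, y, true] := fun x y => by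
    funext i; fin_cases i <;> simp [hδdef]
  have p1 := hpair_off ![true, true, false]; have p2 := hpair_off ![true, false, false]
  have p3 := hpair_off ![false, true, false]; have p4 := hpair_off ![false, false, false]
  have q1 := hpair_on ![true, true, false]; have q2 := hpair_on ![true, false, false]
  have q3 := hpair_on ![false, true, false]; have q4 := hpair_on ![false, false, false]
  simp only [eδ, Matrix.cons_val_zero, Matrix.cons_val_one] at p1 p2 p3 p4 q1 q2 q3 q4
  have r1 := hres ![true, true, true]; have r2 := hres ![true, true, false]; have r3 := hres ![true, false, true]
  have r4 := hres ![true, false, false]; have r5 := hres ![false, true, true]; have r6 := hres ![false, true, false]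
  have r7 := hres ![false, false, true]; have r8 := hres ![false, false, false]
  have k2 := hkt ![true, true, false]; have k4 := hkt ![true, false, false]; have k6 := hkt ![false, true, false]
  have k8 := hkt ![false, false, false]
  cases b₁ <;> cases b₂ <;> simp only [Bool.true_eq_false, Bool.false_eq_true, and_true, and_false,
    not_true_eq_false, not_false_eq_true, forall_const, IsEmpty.forall_iff] at p1 p2 p3 p4 q1 q2 q3 q4
  · -- `(b₁, b₂) = (false, false)`: the on-pair is `![false, false, ·]`
    have := tow_R2_arith (4 * N) _ _ _ _ _ _ _ _ q4 p1 p2 p3 r7 r8 r2 r4 r6 k2 k4 k6 (by omega)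
    omega
  · have := tow_R2_arith (4 * N) _ _ _ _ _ _ _ _ q3 p1 p2 p4 r5 r6 r2 r4 r8 k2 k4 k8 (by omega)
    omega
  · have := tow_R2_arith (4 * N) _ _ _ _ _ _ _ _ q2 p1 p3 p4 r3 r4 r2 r6 r8 k2 k6 k8 (by omega)
    omega
  · have := tow_R2_arith (4 * N) _ _ _ _ _ _ _ _ q1 p2 p3 p4 r1 r2 r4 r6 r8 k4 k6 k8 (by omega)
    omega

end Summit.QuantumAdvantage.QuantumAdvantage.Theorems.CubicForrelation.NearExactIsExact

end
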